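import Summits.CriticalPhenomena.CardyFormulaZ2.Theorems.CardyMagicRigidityNestingRigidityNeckCoveringB
import Summits.CriticalPhenomena.CardyFormulaZ2.Theorems.CardyMagicRigidityNestingRigidityNeckFourArmBoundT
import Summits.CriticalPhenomena.CardyFormulaZ2.Theorems.CardyMagicRigidityNestingRigidityNeckNodeProductT
import HarnessLib

/-!
# Stub S11 `stub_neckHookupCoarseT : NeckHookupCoarseT`: the exact remaining target and its shape (status after wave 4)

Everything below the summation is in the tree (namespace `…PinchResampling`, modules `…Theorems.CardyMagicRigidityNestingRigidity*`):
`NeckCoarseStructure` (p154174), `NeckCoarseReduction` (p154519), `NeckHookStar` (p159286), `NeckHookStarSandwich` (p160769),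
`NeckVirtualEdges` (p161541), `NeckCoveringA` (p162034), `NeckCoveringB` (p162225), `NeckFourArmInputsT` (p161139),
`NeckFourArmBoundT` (p161663), `NeckNodeProductT` (p162284).

The stub itself is OPEN.  The EXACT remaining target is `HookStarApproxT` below (`neckHookupCoarseT_of_hookStarApproxT` is the
landed reduction `neckHookupCoarseT_of_tHookStar`), and `hookStarApproxT_of_absolute` is the shape the summation must deliver
(an ABSOLUTE bound on the two honest error events, plus the positivity (I0)); by `tPinch_inter_symmDiff_subset` it splits into the two honest error events
`THookStar ∖ THook` (covered by `covering_A_nodes`) and `THook ∖ THookBig` (covered by `covering_B_nodes`), whose node events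
are `TFourArmTwoClusters w r R` (`…NeckFourArmInputsT`), jointly independent over disjoint annuli with product cost
`∏ C (rᵢ/Rᵢ)^{1+ε}` given (I4T) (`real_biInter_tFourArmTwoClusters_le_prod_rpow`), and (I4T) holds given the named fact
`SmirnovWerner2001_fourArm_scalingLimit` (`fourArmTwoClustersBoundT_of_scalingLimit`).  Still absent: the multi-scale
summation itself (road map item 2 of `S11_HookStar.lean`), the positivity (I0) `TPinchPositive`, and the touching-necklace
bound (IN) `TouchingNecklaceBoundT` (`S11_Inputs.lean`).
-/

noncomputable section

namespace Summit.CriticalPhenomena.CardyFormulaZ2.Cruxes.NestingRigidity.PinchResampling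

open MeasureTheory Set Literature.Probability.Percolation Literature.Probability.LatticeModels
open scoped symmDiff

/-- **The remaining target of stub S11** (approximation quality of the fuzzy hook-up on the selection event): for every
`b > 0` there is `L` such that in the scale window `1 ≤ ℓ`, `s³ℓ ≤ lam⁴`, `L·lam ≤ s`,
`P(TPinch ∩ (THook ∆ THookStar)) ≤ b² · P(TPinch)`. -/
def HookStarApproxT : Prop :=
  ∀ b : ℝ, 0 < b → ∃ L : ℕ, ∀ (x o : Site 2) (ℓ lam s : ℕ), 1 ≤ ℓ → s ^ 3 * ℓ ≤ lam ^ 4 → L * lam ≤ s →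
    (triSitePercolation half).real (TPinch x x s s ∩ symmDiff (THook x x s s) (THookStar ℓ lam s x o)) ≤
      b ^ 2 * (triSitePercolation half).real (TPinch x x s s)

/-- The stub from the remaining target (landed reduction `neckHookupCoarseT_of_tHookStar`). -/
theorem neckHookupCoarseT_of_hookStarApproxT : HookStarApproxT → NeckHookupCoarseT :=
  fun h ↦ neckHookupCoarseT_of_tHookStar h

/-- The shape in which the summation must deliver the target: an ABSOLUTE bound on the two honest error events plus the
positivity (I0) of the selection event give `HookStarApproxT`. -/
theorem hookStarApproxT_of_absolute : TPinchPositive → (∀ β : ℝ, 0 < β → ∃ L : ℕ, ∀ (x o : Site 2) (ℓ lam s : ℕ), 1 ≤ ℓ → s ^ 3 * ℓ ≤ lam ^ 4 → L * lam ≤ s → (triSitePercolation half).real (TPinch x x s s ∩ ((THookStar ℓ lam s x o \ THook x x s s) ∪ (THook x x s s \ THookBig lam s x))) ≤ β) → HookStarApproxT := by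
  rintro ⟨s₀, c₀, hc₀, hpos⟩ hA
  intro b hb
  obtain ⟨L, hL⟩ := hA (b ^ 2 * c₀) (by positivity)
  refine ⟨max L (s₀ + 1), fun x o ℓ lam s hℓ hw hs ↦ ?_⟩
  have hLs : L * lam ≤ s := le_trans (Nat.mul_le_mul_right lam (le_max_left _ _)) hs
  -- in the window `lam ≥ 1` (from `s³ ℓ ≤ lam⁴` unless `s = 0`), so `s ≥ s₀`; the case `s = 0` is trivial
  rcases Nat.eq_zero_or_pos s with rfl | hs0
  · -- `s = 0`: the annulus `Λ₀(x) ∖ Λ₀(x)` is empty, so `TPinch x x 0 0 = ∅` and both sides vanish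
    have hempty : ∀ ω, ω ∉ TPinch x x 0 0 := by
      rintro ω ⟨⟨⟨v₁, -, ⟨⟨hvOI, -⟩, -⟩, -⟩, -⟩, -⟩
      have h1 : v₁ ∈ tBall x 0 := by simpa using hvOI.1
      exact hvOI.2 h1
    have h0 : TPinch x x 0 0 = ∅ := Set.subset_empty_iff.1 fun ω hω ↦ (hempty ω hω).elim
    rw [h0, Set.empty_inter, measureReal_empty, mul_zero]
  · have hlam : 1 ≤ lam := by
      by_contra hl
      push Not at hl
      have : lam = 0 := by omega
      subst this
      have : s ^ 3 * ℓ = 0 := by simpa using hw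
      have : s ^ 3 = 0 ∨ ℓ = 0 := by simpa [Nat.mul_eq_zero] using this
      rcases this with h | h
      · exact absurd (pow_eq_zero_iff (n := 3) (by norm_num) |>.1 h) (by omega)
      · omega
    have hss₀ : s₀ ≤ s := by
      have : (s₀ + 1) * lam ≤ s := le_trans (Nat.mul_le_mul_right lam (le_max_right _ _)) hs
      nlinarith
    calc (triSitePercolation half).real (TPinch x x s s ∩ symmDiff (THook x x s s) (THookStar ℓ lam s x o))
        ≤ (triSitePercolation half).real
            (TPinch x x s s ∩ ((THookStar ℓ lam s x o \ THook x x s s) ∪ (THook x x s s \ THookBig lam s x))) :=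
          measureReal_mono (fun ω hω ↦ ⟨hω.1, tPinch_inter_symmDiff_subset ℓ lam s x o hω⟩) (measure_ne_top _ _)
      _ ≤ b ^ 2 * c₀ := hL x o ℓ lam s hℓ hw hLs
      _ ≤ b ^ 2 * (triSitePercolation half).real (TPinch x x s s) :=
          mul_le_mul_of_nonneg_left (hpos x s hss₀) (by positivity)

end Summit.CriticalPhenomena.CardyFormulaZ2.Cruxes.NestingRigidity.PinchResampling

end
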